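/-
COR-CM (cell pub-hodgecm2, stage 2 of the Hodge ladder) — count-neutral KERNEL COMBINATORICS «field level of the SYLOW TRANSFER, III: every Galois CM field
of degree 8p (p an odd prime) with an automorphism of order 4p has EXACTLY φ₂(F) generating faces» (seat prover-pub-hodgecm2-b23-g51-0, binder
prover b23, gen 51; own census lane SYLOW TRANSFER, claim HOME/INBOX.md l.23329, blanket `CorCM/FaceSylowTransfer*` l.23357).  Theorems only;
`Census/SylowTransferEightPrime.lean` (this seat), the field transfer `CorCM/FaceGenerationTransfer.lean` and the INT2-GEN socket are used BY NAME;
nothing asserted.  `Interfaces.lean` (C1), every E term, B01, `Transposition/*`, `PortJoin/*`, `D2Bridge/*` untouched.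
HONEST FRAMING: `HC_CM` is NOT proved, here or anywhere in the tree; this file produces no period and proves no face period for any field; §2 is
CONDITIONAL on the face periods exactly as the earlier sockets.
T5: n/a-class (hypothesis binders: `[F:ℚ] = 8p`, `p` an odd prime, an automorphism of order `4p` — inhabited by `ℚ(ζ₁₆)⁺(i)·L`, `D_{8p}`-, `Q_{8p}`-,
`D₄ × ℤ/p`-, `Q₈ × ℤ/p`-fields; checker: self, 2026-08-25).
-/
import Summits.HodgeConjecture.CorCM.Census.SylowTransferEightPrime
import Summits.HodgeConjecture.CorCM.FaceSylowTransfer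
import HarnessLib

/-!
# Field level of the Sylow transfer, III: degree `8p` with an automorphism of order `4p`

**`isLeast_card_faces_hgen_of_aut_orderOf_four_mul_prime`**: a Galois CM field `F` of degree `8p` (`p` an odd prime) with an automorphism `u₀` of
order `4p` (Galois group `ℤ/8p`, `ℤ/4p × ℤ/2`, `D_{8p}`, `Q_{8p}`, `D₄ × ℤ/p`, `Q₈ × ℤ/p`, `ℤ/p ⋊ ℤ/8`, …; complex conjugation ANY central involution)
has EXACTLY `φ₂(F)` generating faces (`Census/SylowTransferEightPrime.lean`).  With `CorCM/FaceSylowTransferRoots.lean` (abelian Sylow) the degree-`8p`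
census is complete except for the Galois groups `X_p = ℤ/p ⋊ D₄` (Klein kernel) and `SL(2,3)` (`p = 3`).  §2: the CONDITIONAL Hodge-conjecture
reading through the INT2-GEN socket.  `HC_CM` is NOT proved.

## References
* [Pohlmann1968] H. Pohlmann, Algebraic cycles on abelian varieties of complex multiplication type, Ann. of Math. 88 (1968), Thm 1.
* [Shimura1998] G. Shimura, Abelian Varieties with Complex Multiplication and Modular Functions, §6.2 Thm. 3, §8.1.
-/

noncomputable section

open CategoryTheory NumberField NumberField.ComplexEmbedding
open Literature.AlgebraicGeometry Literature.AlgebraicGeometry.Motives Literature.AlgebraicGeometry.HodgeTheory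
open Literature.AlgebraicGeometry.ComplexMultiplication Literature.AlgebraicGeometry.Milne1999
open Literature.NumberTheory.Automorphic
open Literature.NumberTheory.Automorphic.PicardCM
open Summit.HodgeConjecture.CorCM.Domination

namespace Summit.HodgeConjecture.CorCM.FaceSylowTransfer

open Summit.HodgeConjecture.CorCM.Prior.AllgGroup.RfwfAllgGroup
open Summit.HodgeConjecture.CorCM.Census.BlockParity
open Summit.HodgeConjecture.CorCM.Census.Coinvariant
open Summit.HodgeConjecture.CorCM.Census
open Summit.HodgeConjecture.CorCM.FaceCensus.OddSlice (galTOfAut galTOfAut_mul galTOfAut_conjAut)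

section Field

variable {F : Type} [Field F] [NumberField F]

/-! ## §1 Exactly `φ₂(F)` generating faces -/

/-- **DEGREE `8p`, AN ELEMENT OF ORDER `4p` IN THE GALOIS TRANSLATES ⟹ EXACTLY `φ₂(F)` GENERATING FACES** (`p` an odd prime). [folklore] -/
theorem isLeast_card_faces_hgen_of_orderOf_four_mul_prime [IsCMField F] [IsGalois ℚ F] {p : ℕ} (hp : p.Prime) (hp2 : p ≠ 2)
    (hdeg : Module.finrank ℚ F = 8 * p) (u : GalT F) (hord : orderOf u = 4 * p) (σ₀ : F →+* ℂ) :
    IsLeast {n : ℕ | ∃ 𝒮 : Finset (Face F), 𝒮.card = n ∧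
      ∀ f : Face F, lefChar f.corner (fun _ => ({σ₀} : Finset (F →+* ℂ))) ∈ AddSubgroup.closure
        {a : Asym F | ∃ g ∈ (𝒮 : Set (Face F)), ∃ σ : F →+* ℂ, a = lefChar g.corner (fun _ => ({σ} : Finset (F →+* ℂ)))}}
      (fibreTwo (conjT : GalT F) conjT_mul_self) := by
  refine FaceTransfer.isLeast_card_faces_hgen_of_intrinsic _ ?_ (fun S₀ hS₀ hS => ?_) σ₀
  · obtain ⟨S, hS, hcard, hgen⟩ := (SylowTransfer.isLeast_card_gfaces_generate_fibreTwo_of_card_eq_eight_mul_prime conjT hp hp2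
      ((FaceCensus.card_galT (F := F)).trans hdeg) u hord conjT_mul_self conjT_ne_one FaceBasis.conjT_comm).1
    exact ⟨S, hS, hcard.le, hgen⟩
  · exact fibreTwo_le_card conjT conjT_mul_self FaceBasis.conjT_comm S₀ (Submodule.span ℤ (pairSet conjT)) le_rfl hS₀
      (fun y hy => hS (gfaceSet_subset_hodgeSpan conjT conjT_mul_self hy))

/-- **… automorphism form**: `[F:ℚ] = 8p` and `u₀ ∈ Aut(F)` of order `4p`. [folklore] -/
theorem isLeast_card_faces_hgen_of_aut_orderOf_four_mul_prime [IsCMField F] [IsGalois ℚ F] (σ₀ : F →+* ℂ) {p : ℕ} (hp : p.Prime) (hp2 : p ≠ 2)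
    (hdeg : Module.finrank ℚ F = 8 * p) (u₀ : F ≃ₐ[ℚ] F) (hord : orderOf u₀ = 4 * p) :
    IsLeast {n : ℕ | ∃ 𝒮 : Finset (Face F), 𝒮.card = n ∧
      ∀ f : Face F, lefChar f.corner (fun _ => ({σ₀} : Finset (F →+* ℂ))) ∈ AddSubgroup.closure
        {a : Asym F | ∃ g ∈ (𝒮 : Set (Face F)), ∃ σ : F →+* ℂ, a = lefChar g.corner (fun _ => ({σ} : Finset (F →+* ℂ)))}}
      (fibreTwo (conjT : GalT F) conjT_mul_self) := by
  set e : (F ≃ₐ[ℚ] F) ≃* GalT F := MulEquiv.mk' (galTOfAut σ₀) (galTOfAut_mul σ₀) with he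
  have hord' : orderOf (e u₀) = 4 * p := by rw [← hord]; exact orderOf_injective e.toMonoidHom e.injective u₀
  exact isLeast_card_faces_hgen_of_orderOf_four_mul_prime hp hp2 hdeg (e u₀) hord' σ₀

end Field

/-! ## §2 The Hodge-conjecture reading through the INT2-GEN socket (conditional on the face periods) -/

/-- **HC for the slice of a Galois CM field of degree `8p` with an automorphism of order `4p`, from `φ₂(K)` face periods** (CONDITIONAL; `HC_CM` is NOT
proved). [cite: Shimura1998, §6.2 Theorem 3 and §6.1 Corollary of Theorem 2 (pp. 41–43)] [cite: Pohlmann1968, Thm. 1]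
[cite: Milne1999LefschetzClasses, Thm. 3.2 and Cor. 4.5] [cite: MumfordAV1970, §19 Thm. 1 and p. 169] -/
theorem hodgeConjectureFor_of_aut_orderOf_four_mul_prime_of_exists_facePeriod (K : CMField) [hGal : IsGalois ℚ K] (σ₀ : (K : Type) →+* ℂ)
    {p : ℕ} (hp : p.Prime) (hp2 : p ≠ 2) (hdeg : Module.finrank ℚ K = 8 * p) (u₀ : (K : Type) ≃ₐ[ℚ] (K : Type)) (hord : orderOf u₀ = 4 * p) :
    ∃ 𝒮 : Finset (Face K), 𝒮.card = fibreTwo (conjT : GalT K) conjT_mul_self ∧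
      ((∀ f ∈ 𝒮, ∃ ι₁ : K →+* ℂ, f.Admissible ι₁ ∧ ∃ (V : HermSpace3 K ι₁) (σ : K →+* ℂ),
        (Model.picardCMUniverse exists_isReal_hodgeModel_holds hodgePQ_independent_of_hodgeModel_holds
          BallQuotient.ballQuotientUniformised_holds cmAbelianVarietyRealised_holds).PeriodNV ι₁ V K f.psi σ) →
      ∀ {P B : AbelianVariety ℂ}, AbelianVariety.IsProductOf (fun B : AbelianVariety ℂ =>
        ∃ (E : Type) (_ : Field E) (_ : NumberField E) (_ : IsCMField E) (_ : E →+* (K : Type)) (Φ : CMType E)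
          (ι : 𝓞 E →+* End B) (ϑ : E →+* Module.End ℂ (complexBetti B.X 1)),
          IsCMTypeRealisation Φ B ι ϑ) P →
      AVDominatedBy B P → HodgeConjectureFor B.dim B.X) := by
  obtain ⟨⟨𝒮, hcard, hgen⟩, -⟩ := isLeast_card_faces_hgen_of_aut_orderOf_four_mul_prime (F := K) σ₀ hp hp2 hdeg u₀ hord
  refine ⟨𝒮, hcard, fun h P B hP hB => ?_⟩
  have h6 : 6 ≤ Module.finrank ℚ K := by rw [hdeg]; have := hp.two_le; omega
  exact hodgeConjectureFor_of_avDominatedBy_isProductOf_of_exists_facePeriod_on K h6 (𝒮 : Set (Face K)) σ₀ hgen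
    (fun f hf => h f (Finset.mem_coe.mp hf)) hP hB

end Summit.HodgeConjecture.CorCM.FaceSylowTransfer
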